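import Summits.FinalStateConjecture.FinalStateConjecture.Theses.PhotonSphereChannels
import Summits.FinalStateConjecture.FinalStateConjecture.Theses.RobustClausewiseGenericity

/-! Scratch (crux-strategist): the four children of the split of `TameCensorship`, elaborated in the route-file
context, dedup sanity against the sibling items, and the δ-match of the glue type of `tameCensorship_of_subs`. -/

namespace Summit.FinalStateConjecture.FinalStateConjecture.Theses.PhotonSphereChannels

open scoped BigOperators Topology Manifold Classical MeasureTheory ProbabilityTheory Matrix InnerProductSpace ComplexConjugate ContinuousMap
open Filter Set Function TopologicalSpace MeasureTheory

def FGExtremalChartFreeResidual : Prop :=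
  ∀ (X : Type) [TopologicalSpace X] [ChartedSpace Literature.Geometry.Lorentzian.E3 X] [IsManifold (𝓡 3) ((⊤ : ℕ∞) : WithTop ℕ∞) X] [T2Space X] [SecondCountableTopology X] [ConnectedSpace X], ∀ d ∈ Literature.Geometry.Lorentzian.admissibleVacuumData X, ∀ (m : ℕ) (G : EuclideanSpace ℝ (Fin m) → Literature.Geometry.Lorentzian.InitialDataSet (𝓡 3) X), (Literature.Geometry.Lorentzian.InitialDataSet.IsSmoothDataFamily m G ∧ G 0 = d ∧ (∀ c, G c ∈ Literature.Geometry.Lorentzian.admissibleVacuumData X) ∧ ∃ K : Set X, IsCompact K ∧ ∀ c, ∀ x ∉ K, (G c).h.inner x = d.h.inner x ∧ (G c).k x = d.k x) → ∃ (n : ℕ) (G₁ : EuclideanSpace ℝ (Fin n) → Literature.Geometry.Lorentzian.InitialDataSet (𝓡 3) X) (L : EuclideanSpace ℝ (Fin m) →ₗ[ℝ] EuclideanSpace ℝ (Fin n)), Function.Injective L ∧ (Literature.Geometry.Lorentzian.InitialDataSet.IsSmoothDataFamily n G₁ ∧ G₁ 0 = d ∧ (∀ c, G₁ c ∈ Literature.Geometry.Lorentzian.admissibleVacuumData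 X) ∧ ∃ K : Set X, IsCompact K ∧ ∀ c, ∀ x ∉ K, (G₁ c).h.inner x = d.h.inner x ∧ (G₁ c).k x = d.k x) ∧ (∀ c, G₁ (L c) = G c) ∧ ∀ (p : ℕ) (G₂ : EuclideanSpace ℝ (Fin p) → Literature.Geometry.Lorentzian.InitialDataSet (𝓡 3) X) (L' : EuclideanSpace ℝ (Fin n) →ₗ[ℝ] EuclideanSpace ℝ (Fin p)), Function.Injective L' → (Literature.Geometry.Lorentzian.InitialDataSet.IsSmoothDataFamily p G₂ ∧ G₂ 0 = d ∧ (∀ c, G₂ c ∈ Literature.Geometry.Lorentzian.admissibleVacuumData X) ∧ ∃ K : Set X, IsCompact K ∧ ∀ c, ∀ x ∉ K, (G₂ c).h.inner x = d.h.inner x ∧ (G₂ c).k x = d.k x) → (∀ c, G₂ (L' c) = G₁ c) → ∃ U : Set (EuclideanSpace ℝ (Fin p)), U ∈ residual (EuclideanSpace ℝ (Fin p)) ∧ ∀ v ∈ U, ∃ δ : ℝ, 0 < δ ∧ ∀ t : ℝ, t ≠ 0 → |t| < δ → ∀ 𝒟 : Literature.Geometry.Lorentzian.VacuumCauchyDevelopment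 (G₂ (t • v)), 𝒟.IsMaximal → ∀ (Λ : Literature.Geometry.Lorentzian.lorentzGroup) (c : Literature.Geometry.Lorentzian.E4) (M a : ℝ), Literature.Geometry.Lorentzian.Kerr.IsExtremal M a → ¬ ∃ (τ₀ : ℝ) (Ψ : (Literature.Geometry.Lorentzian.boostedKerrBackground Λ c M a).domain → 𝒟.carrier), 𝒟.toSpacetime.IsLateChart (Literature.Geometry.Lorentzian.boostedKerrBackground Λ c M a) Set.univ τ₀ Ψ ∧ (∀ ρ : ℝ, ∀ᶠ τ in Filter.atTop, ∀ x ∈ (Literature.Geometry.Lorentzian.boostedKerrBackground Λ c M a).truncTimeSlab ρ τ, 𝒟.timeOrientation.IsFutureDirected (mfderiv 𝓘(ℝ, Literature.Geometry.Lorentzian.E4) (𝓡 4) Ψ x ((Λ : Literature.Geometry.Lorentzian.E4 ≃L[ℝ] Literature.Geometry.Lorentzian.E4) (Literature.Geometry.Lorentzian.Kerr.timeVector M a (Literature.Geometry.Lorentzian.poincareInv Λ c (x : Literature.Geometry.Lorentzian.E4)))))) ∧ ∀ R : ℝ, Filter.Tendsto (fun τ => 𝒟.toSpacetime.truncDeviationCk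 (Literature.Geometry.Lorentzian.boostedKerrBackground Λ c M a) Ψ 2 R τ) Filter.atTop (nhds 0)

def TameOuterResidual : Prop :=
  ∀ (X : Type) [TopologicalSpace X] [ChartedSpace Literature.Geometry.Lorentzian.E3 X] [IsManifold (𝓡 3) ((⊤ : ℕ∞) : WithTop ℕ∞) X] [T2Space X] [SecondCountableTopology X] [ConnectedSpace X], ∀ d ∈ Literature.Geometry.Lorentzian.admissibleVacuumData X, ∀ (m : ℕ) (G : EuclideanSpace ℝ (Fin m) → Literature.Geometry.Lorentzian.InitialDataSet (𝓡 3) X), (Literature.Geometry.Lorentzian.InitialDataSet.IsSmoothDataFamily m G ∧ G 0 = d ∧ (∀ c, G c ∈ Literature.Geometry.Lorentzian.admissibleVacuumData X) ∧ ∃ K : Set X, IsCompact K ∧ ∀ c, ∀ x ∉ K, (G c).h.inner x = d.h.inner x ∧ (G c).k x = d.k x) → ∃ (n : ℕ) (G₁ : EuclideanSpace ℝ (Fin n) → Literature.Geometry.Lorentzian.InitialDataSet (𝓡 3) X) (L : EuclideanSpace ℝ (Fin m) →ₗ[ℝ] EuclideanSpace ℝ (Fin n)), Function.Injective L ∧ (Literature.Geometry.Lorentzian.InitialDataSet.IsSmoothDataFamily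 n G₁ ∧ G₁ 0 = d ∧ (∀ c, G₁ c ∈ Literature.Geometry.Lorentzian.admissibleVacuumData X) ∧ ∃ K : Set X, IsCompact K ∧ ∀ c, ∀ x ∉ K, (G₁ c).h.inner x = d.h.inner x ∧ (G₁ c).k x = d.k x) ∧ (∀ c, G₁ (L c) = G c) ∧ ∀ (p : ℕ) (G₂ : EuclideanSpace ℝ (Fin p) → Literature.Geometry.Lorentzian.InitialDataSet (𝓡 3) X) (L' : EuclideanSpace ℝ (Fin n) →ₗ[ℝ] EuclideanSpace ℝ (Fin p)), Function.Injective L' → (Literature.Geometry.Lorentzian.InitialDataSet.IsSmoothDataFamily p G₂ ∧ G₂ 0 = d ∧ (∀ c, G₂ c ∈ Literature.Geometry.Lorentzian.admissibleVacuumData X) ∧ ∃ K : Set X, IsCompact K ∧ ∀ c, ∀ x ∉ K, (G₂ c).h.inner x = d.h.inner x ∧ (G₂ c).k x = d.k x) → (∀ c, G₂ (L' c) = G₁ c) → ∃ U : Set (EuclideanSpace ℝ (Fin p)), U ∈ residual (EuclideanSpace ℝ (Fin p)) ∧ ∀ v ∈ U, ∃ δ : ℝ, 0 < δ ∧ ∀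 t : ℝ, t ≠ 0 → |t| < δ → ∀ 𝒟 : Literature.Geometry.Lorentzian.VacuumCauchyDevelopment (G₂ (t • v)), 𝒟.IsMaximal → ∀ [𝒟.metric.HasLeviCivita], let outer : Set 𝒟.carrier := 𝒟.metric.causalFuture 𝒟.timeOrientation (Set.range 𝒟.embed) ∩ {q | ∃ (p : X) (γ : ℝ → 𝒟.carrier) (dom : Set ℝ), 𝒟.metric.IsNormalisedNullRayFrom 𝒟.timeOrientation 𝒟.embed 𝒟.normal p γ dom ∧ ¬ BddAbove dom ∧ q ∈ 𝒟.metric.chronologicalPast 𝒟.timeOrientation (γ '' (dom ∩ Set.Ici 0))}; ∃ r₀ : ℝ, 0 < r₀ ∧ ∃ Λ : NNReal, ∀ q ∈ outer, let U : TopologicalSpace.Opens Literature.Geometry.Lorentzian.E4 := ⟨Metric.ball (0 : Literature.Geometry.Lorentzian.E4) r₀, Metric.isOpen_ball⟩; ∃ Ψ : U → 𝒟.carrier, 𝒟.toSpacetime.IsLateChart (Literature.Geometry.Lorentzian.Minkowski.backgroundOn U) Set.univ (-r₀) Ψ ∧ (∃ x : U, (x : Literature.Geometry.Lorentzian.E4)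 = 0 ∧ Ψ x = q) ∧ Literature.Geometry.Lorentzian.supCkENorm (U : Set Literature.Geometry.Lorentzian.E4) 3 (𝒟.toSpacetime.deviationExtend (Literature.Geometry.Lorentzian.Minkowski.backgroundOn U) Ψ) ≤ (Λ : ENNReal) ∧ Literature.Geometry.Lorentzian.supCkENorm (U : Set Literature.Geometry.Lorentzian.E4) 0 (𝒟.toSpacetime.deviationExtend (Literature.Geometry.Lorentzian.Minkowski.backgroundOn U) Ψ) ≤ 1 / 2

def MGHDExists : Prop :=
  ∀ (X : Type) [TopologicalSpace X] [ChartedSpace Literature.Geometry.Lorentzian.E3 X] [IsManifold (𝓡 3) ((⊤ : ℕ∞) : WithTop ℕ∞) X] [T2Space X] [SecondCountableTopology X] [ConnectedSpace X], ∀ D ∈ Literature.Geometry.Lorentzian.admissibleVacuumData X, ∃ 𝒟 : Literature.Geometry.Lorentzian.VacuumCauchyDevelopment D, 𝒟.IsMaximal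

def CensorshipRobust : Prop :=
  ∀ (X : Type) [TopologicalSpace X] [ChartedSpace Literature.Geometry.Lorentzian.E3 X] [IsManifold (𝓡 3) ((⊤ : ℕ∞) : WithTop ℕ∞) X] [T2Space X] [SecondCountableTopology X] [ConnectedSpace X], ∀ d ∈ Literature.Geometry.Lorentzian.admissibleVacuumData X, let Tame : (m : ℕ) → (EuclideanSpace ℝ (Fin m) → Literature.Geometry.Lorentzian.InitialDataSet (𝓡 3) X) → Prop := fun m G ↦ Literature.Geometry.Lorentzian.InitialDataSet.IsSmoothDataFamily m G ∧ G 0 = d ∧ (∀ c, G c ∈ Literature.Geometry.Lorentzian.admissibleVacuumData X) ∧ ∃ K : Set X, IsCompact K ∧ ∀ c, ∀ x ∉ K, (G c).h.inner x = d.h.inner x ∧ (G c).k x = d.k x; let Q : Literature.Geometry.Lorentzian.InitialDataSet (𝓡 3) X → Prop := fun D ↦ ∀ 𝒟 : Literature.Geometry.Lorentzian.VacuumCauchyDevelopment D, 𝒟.IsMaximal → Summit.FinalStateConjecture.HasCompleteNullInfinity 𝒟.toCauchyDevelopment; ∀ (m : ℕ) (G : EuclideanSpace ℝ (Fin m) →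 Literature.Geometry.Lorentzian.InitialDataSet (𝓡 3) X), Tame m G → ∃ (n : ℕ) (G₁ : EuclideanSpace ℝ (Fin n) → Literature.Geometry.Lorentzian.InitialDataSet (𝓡 3) X) (L : EuclideanSpace ℝ (Fin m) →ₗ[ℝ] EuclideanSpace ℝ (Fin n)), Function.Injective L ∧ Tame n G₁ ∧ (∀ c, G₁ (L c) = G c) ∧ ∀ (p : ℕ) (G₂ : EuclideanSpace ℝ (Fin p) → Literature.Geometry.Lorentzian.InitialDataSet (𝓡 3) X) (L' : EuclideanSpace ℝ (Fin n) →ₗ[ℝ] EuclideanSpace ℝ (Fin p)), Function.Injective L' → Tame p G₂ → (∀ c, G₂ (L' c) = G₁ c) → ∃ U : Set (EuclideanSpace ℝ (Fin p)), IsOpen U ∧ Dense U ∧ ∀ v ∈ U, ∃ δ : ℝ, 0 < δ ∧ ∀ t : ℝ, t ≠ 0 → |t| < δ → Q (G₂ (t • v))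

example : MGHDExists ↔ Summit.FinalStateConjecture.FinalStateConjecture.Theses.RobustClausewiseGenericity.MGHDExists :=
  Iff.rfl

example : CensorshipRobust ↔
    Summit.FinalStateConjecture.FinalStateConjecture.Theses.RobustClausewiseGenericity.CensorshipRobust :=
  Iff.rfl

section GlueCheck
open Literature.Geometry.Lorentzian
open scoped ContDiff

/-- δ-match: a term of the (def-free) type of `TameCensorshipSplit.tameCensorship_of_subs` proves the glue statement of
the split over the route decls. -/
theorem glue_check (h :
    (∀ (X : Type) [TopologicalSpace X] [ChartedSpace E3 X] [IsManifold (𝓡 3) ∞ X] [T2Space X]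
    [SecondCountableTopology X] [ConnectedSpace X], ∀ d ∈ admissibleVacuumData X, ∀ (m : ℕ) (G : EuclideanSpace ℝ
    (Fin m) → InitialDataSet (𝓡 3) X), (InitialDataSet.IsSmoothDataFamily m G ∧ G 0 = d ∧ (∀ c, G c ∈
    admissibleVacuumData X) ∧ ∃ K : Set X, IsCompact K ∧ ∀ c, ∀ x ∉ K, (G c).h.inner x = d.h.inner x ∧ (G c).k x =
    d.k x) → ∃ (n : ℕ) (G₁ : EuclideanSpace ℝ (Fin n) → InitialDataSet (𝓡 3) X) (L : EuclideanSpace ℝ (Fin m)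
    →ₗ[ℝ] EuclideanSpace ℝ (Fin n)), Injective L ∧ (InitialDataSet.IsSmoothDataFamily n G₁ ∧ G₁ 0 = d ∧ (∀ c, G₁ c
    ∈ admissibleVacuumData X) ∧ ∃ K : Set X, IsCompact K ∧ ∀ c, ∀ x ∉ K, (G₁ c).h.inner x = d.h.inner x ∧ (G₁ c).k
    x = d.k x) ∧ (∀ c, G₁ (L c) = G c) ∧ ∀ (p : ℕ) (G₂ : EuclideanSpace ℝ (Fin p) → InitialDataSet (𝓡 3) X) (L' :
    EuclideanSpace ℝ (Fin n) →ₗ[ℝ] EuclideanSpace ℝ (Fin p)), Injective L' → (InitialDataSet.IsSmoothDataFamily p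
    G₂ ∧ G₂ 0 = d ∧ (∀ c, G₂ c ∈ admissibleVacuumData X) ∧ ∃ K : Set X, IsCompact K ∧ ∀ c, ∀ x ∉ K, (G₂ c).h.inner
    x = d.h.inner x ∧ (G₂ c).k x = d.k x) → (∀ c, G₂ (L' c) = G₁ c) → ∃ U : Set (EuclideanSpace ℝ (Fin p)), U ∈ residual (EuclideanSpace ℝ (Fin p)) ∧ ∀ v ∈ U, ∃ δ : ℝ, 0 < δ ∧ ∀ t : ℝ, t ≠ 0 → |t| < δ → ∀ 𝒟 : VacuumCauchyDevelopment (G₂ (t • v)),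
    𝒟.IsMaximal → ∀ (Λ : lorentzGroup) (c : E4) (M a : ℝ), Kerr.IsExtremal M a → ¬ ∃ (τ₀ : ℝ) (Ψ :
    (boostedKerrBackground Λ c M a).domain → 𝒟.carrier), 𝒟.toSpacetime.IsLateChart (boostedKerrBackground Λ c M a)
    univ τ₀ Ψ ∧ (∀ ρ : ℝ, ∀ᶠ τ in atTop, ∀ x ∈ (boostedKerrBackground Λ c M a).truncTimeSlab ρ τ,
    𝒟.timeOrientation.IsFutureDirected (mfderiv 𝓘(ℝ, E4) (𝓡 4) Ψ x ((Λ : E4 ≃L[ℝ] E4) (Kerr.timeVector M a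
    (poincareInv Λ c (x : E4)))))) ∧ ∀ R : ℝ, Tendsto (fun τ => 𝒟.toSpacetime.truncDeviationCk
    (boostedKerrBackground Λ c M a) Ψ 2 R τ) atTop (nhds 0)) → (∀ (X : Type) [TopologicalSpace X] [ChartedSpace E3
    X] [IsManifold (𝓡 3) ∞ X] [T2Space X] [SecondCountableTopology X] [ConnectedSpace X], ∀ d ∈
    admissibleVacuumData X, ∀ (m : ℕ) (G : EuclideanSpace ℝ (Fin m) → InitialDataSet (𝓡 3) X),
    (InitialDataSet.IsSmoothDataFamily m G ∧ G 0 = d ∧ (∀ c, G c ∈ admissibleVacuumData X) ∧ ∃ K : Set X,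
    IsCompact K ∧ ∀ c, ∀ x ∉ K, (G c).h.inner x = d.h.inner x ∧ (G c).k x = d.k x) → ∃ (n : ℕ) (G₁ :
    EuclideanSpace ℝ (Fin n) → InitialDataSet (𝓡 3) X) (L : EuclideanSpace ℝ (Fin m) →ₗ[ℝ] EuclideanSpace ℝ (Fin
    n)), Injective L ∧ (InitialDataSet.IsSmoothDataFamily n G₁ ∧ G₁ 0 = d ∧ (∀ c, G₁ c ∈ admissibleVacuumData X) ∧
    ∃ K : Set X, IsCompact K ∧ ∀ c, ∀ x ∉ K, (G₁ c).h.inner x = d.h.inner x ∧ (G₁ c).k x = d.k x) ∧ (∀ c, G₁ (L c)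
    = G c) ∧ ∀ (p : ℕ) (G₂ : EuclideanSpace ℝ (Fin p) → InitialDataSet (𝓡 3) X) (L' : EuclideanSpace ℝ (Fin n)
    →ₗ[ℝ] EuclideanSpace ℝ (Fin p)), Injective L' → (InitialDataSet.IsSmoothDataFamily p G₂ ∧ G₂ 0 = d ∧ (∀ c, G₂
    c ∈ admissibleVacuumData X) ∧ ∃ K : Set X, IsCompact K ∧ ∀ c, ∀ x ∉ K, (G₂ c).h.inner x = d.h.inner x ∧ (G₂
    c).k x = d.k x) → (∀ c, G₂ (L' c) = G₁ c) → ∃ U : Set (EuclideanSpace ℝ (Fin p)), U ∈ residual (EuclideanSpace ℝ (Fin p)) ∧ ∀ v ∈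
    U, ∃ δ : ℝ, 0 < δ ∧ ∀ t : ℝ, t ≠ 0 → |t| < δ → ∀ 𝒟 : VacuumCauchyDevelopment (G₂ (t • v)), 𝒟.IsMaximal → ∀
    [𝒟.metric.HasLeviCivita],
    let outer : Set 𝒟.carrier := 𝒟.metric.causalFuture 𝒟.timeOrientation (range 𝒟.embed) ∩ {q | ∃ (p : X) (γ : ℝ →
        𝒟.carrier) (dom : Set ℝ), 𝒟.metric.IsNormalisedNullRayFrom 𝒟.timeOrientation 𝒟.embed 𝒟.normal p γ dom ∧ ¬
        BddAbove dom ∧ q ∈ 𝒟.metric.chronologicalPast 𝒟.timeOrientation (γ '' (dom ∩ Ici 0))};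
    ∃ r₀ : ℝ, 0 < r₀ ∧ ∃ Λ : NNReal, ∀ q ∈ outer,
    let U : TopologicalSpace.Opens E4 := ⟨Metric.ball (0 : E4) r₀, Metric.isOpen_ball⟩;
    ∃ Ψ : U → 𝒟.carrier, 𝒟.toSpacetime.IsLateChart (Minkowski.backgroundOn U) univ (-r₀) Ψ ∧ (∃ x : U, (x : E4) =
    0 ∧ Ψ x = q) ∧ supCkENorm (U : Set E4) 3 (𝒟.toSpacetime.deviationExtend (Minkowski.backgroundOn U) Ψ) ≤ (Λ :
    ENNReal) ∧ supCkENorm (U : Set E4) 0 (𝒟.toSpacetime.deviationExtend (Minkowski.backgroundOn U) Ψ) ≤ 1 / 2) →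
    (∀ (X : Type) [TopologicalSpace X] [ChartedSpace E3 X] [IsManifold (𝓡 3) ∞ X] [T2Space X]
    [SecondCountableTopology X] [ConnectedSpace X], ∀ D ∈ admissibleVacuumData X, ∃ 𝒟 : VacuumCauchyDevelopment D,
    𝒟.IsMaximal) →
    (∀ (X : Type) [TopologicalSpace X] [ChartedSpace E3 X] [IsManifold (𝓡 3) ∞ X] [T2Space X]
    [SecondCountableTopology X] [ConnectedSpace X], ∀ d ∈ admissibleVacuumData X,
    let Tame : (m : ℕ) → (EuclideanSpace ℝ (Fin m) → InitialDataSet (𝓡 3) X) → Prop := fun m G ↦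
        InitialDataSet.IsSmoothDataFamily m G ∧ G 0 = d ∧ (∀ c, G c ∈ admissibleVacuumData X) ∧ ∃ K : Set X,
        IsCompact K ∧ ∀ c, ∀ x ∉ K, (G c).h.inner x = d.h.inner x ∧ (G c).k x = d.k x;
    let Q : InitialDataSet (𝓡 3) X → Prop := fun D ↦ ∀ 𝒟 : VacuumCauchyDevelopment D, 𝒟.IsMaximal →
        HasCompleteNullInfinity 𝒟.toCauchyDevelopment;
    ∀ (m : ℕ) (G : EuclideanSpace ℝ (Fin m) → InitialDataSet (𝓡 3) X), Tame m G → ∃ (n : ℕ) (G₁ : EuclideanSpace ℝ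
    (Fin n) → InitialDataSet (𝓡 3) X) (L : EuclideanSpace ℝ (Fin m) →ₗ[ℝ] EuclideanSpace ℝ (Fin n)), Function.Injective
    L ∧ Tame n G₁ ∧ (∀ c, G₁ (L c) = G c) ∧ ∀ (p : ℕ) (G₂ : EuclideanSpace ℝ (Fin p) → InitialDataSet (𝓡 3) X) (L' :
    EuclideanSpace ℝ (Fin n) →ₗ[ℝ] EuclideanSpace ℝ (Fin p)), Function.Injective L' → Tame p G₂ → (∀ c, G₂ (L' c) =
    G₁ c) → ∃ U : Set (EuclideanSpace ℝ (Fin p)), IsOpen U ∧ Dense U ∧ ∀ v ∈ U, ∃ δ : ℝ, 0 < δ ∧ ∀ t : ℝ, t ≠ 0 →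
    |t| < δ → Q (G₂ (t • v))) →
    ∀ (X : Type) [TopologicalSpace X] [ChartedSpace E3 X] [IsManifold (𝓡 3) ∞ X] [T2Space X]
    [SecondCountableTopology X] [ConnectedSpace X], InitialDataSet.IsTameChristodoulouGeneric (admissibleVacuumData X) (fun D => (∃ 𝒟 :
    VacuumCauchyDevelopment D, 𝒟.IsMaximal) ∧ ∀ 𝒟 : VacuumCauchyDevelopment D, 𝒟.IsMaximal →
    HasCompleteNullInfinity 𝒟.toCauchyDevelopment ∧ ((∀ (Λ : lorentzGroup) (c : E4) (M a : ℝ), Kerr.IsExtremal M a →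
    ¬ ∃ (τ₀ : ℝ) (Ψ : (boostedKerrBackground Λ c M a).domain → 𝒟.carrier), 𝒟.toSpacetime.IsLateChart
    (boostedKerrBackground Λ c M a) Set.univ τ₀ Ψ ∧ ∀ R : ℝ, Filter.Tendsto (fun τ => 𝒟.toSpacetime.truncDeviationCk
    (boostedKerrBackground Λ c M a) Ψ 2 R τ) Filter.atTop (nhds 0)) ∧ ∀ [𝒟.metric.HasLeviCivita],
    let outer : Set 𝒟.carrier := 𝒟.metric.causalFuture 𝒟.timeOrientation (Set.range 𝒟.embed) ∩ {q | ∃ (p : X) (γ :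
        ℝ → 𝒟.carrier) (dom : Set ℝ), 𝒟.metric.IsNormalisedNullRayFrom 𝒟.timeOrientation 𝒟.embed 𝒟.normal p γ dom
        ∧ ¬ BddAbove dom ∧ q ∈ 𝒟.metric.chronologicalPast 𝒟.timeOrientation (γ '' (dom ∩ Set.Ici 0))};
    ∃ r₀ : ℝ, 0 < r₀ ∧ ∃ Λ : NNReal, ∀ q ∈ outer,
    let U : TopologicalSpace.Opens E4 := ⟨Metric.ball (0 : E4) r₀, Metric.isOpen_ball⟩;
    ∃ Ψ : U → 𝒟.carrier, 𝒟.toSpacetime.IsLateChart (Minkowski.backgroundOn U) Set.univ (-r₀) Ψ ∧ (∃ x : U, (x :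
    E4) = 0 ∧ Ψ x = q) ∧ supCkENorm (U : Set E4) 3 (𝒟.toSpacetime.deviationExtend (Minkowski.backgroundOn U) Ψ) ≤
    (Λ : ENNReal) ∧ supCkENorm (U : Set E4) 0 (𝒟.toSpacetime.deviationExtend (Minkowski.backgroundOn U) Ψ) ≤ 1
    / 2)) 1) :
    FGExtremalChartFreeResidual → TameOuterResidual → MGHDExists → CensorshipRobust → TameCensorship :=
  h

/-- and the split children 1–2 are literally the registered kernel stubs' statements (short-name form used by the
skeleton): -/
example (h : FGExtremalChartFreeResidual) : True := trivial

end GlueCheck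

end Summit.FinalStateConjecture.FinalStateConjecture.Theses.PhotonSphereChannels
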